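import Literature.Computability.AlgebraicComplexity.HopcroftKerrRowLemma
import HarnessLib

/-!
# Hopcroft–Kerr's row lemma for matrix multiplication with DELETED `X`-entries
# (the constrained tensors of substitution searches; e.g. `⟨3,3,3⟩` with `a₀₀ = 0`)

Topic `Literature/Computability/AlgebraicComplexity`.  Everything is PROVED over an arbitrary field;
no named facts, no definitions.  Continuation of `HopcroftKerrRowLemma.lean` (Hopcroft–Kerr 1971,
Lemma 7, general form): the same inequality for the tensor of `(A, X) ↦ AX` with the first matrix
`A` restricted to a COORDINATE PATTERN (a set of admissible entries `Pr`), which is how the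
substitution method meets it ("set `a₁₁ = 0`", Hopcroft–Kerr 1971 p. 20; the constrained tensors
`T_U` of Wang 2026, §3).  For a row `i₀` with `p'` admissible entries the overlap factor is `p'`:

* `hopcroftKerr1971_lemma7_row_restrict` — `R(T') + n + |D| ≤ |σ| + ⌊|D| / p'⌋`, `T'` the tensor with
  row `i₀` deleted as well, `D` the terms whose `A`-form is supported on the admissible entries of
  row `i₀`.
* `⟨3,3,3⟩` with the entry `a₀₀` deleted (`T_W`, `W = {a₀₀ = 0}`; the "orbit of `E₀₀`"; written with
  local notations `(fun (a : Fin 3 × Fin 3) (b : {b : Fin 3 × Fin 3 // b ≠ (0, 0)}) (c : Fin 3 × Fin 3) =>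
      matMulTensor K 3 3 3 a b.1 c)`, `(fun (a : Fin 2 × Fin 3) (b : {b : Fin 2 × Fin 3 // b ≠ (0, 0)}) (c : Fin 3 × Fin 3) =>
      matMulTensor K 2 3 3 a b.1 c)` = `fun a b c => matMulTensor K 3 3 3 a b.1 c` on `{b // b ≠ (0,0)}`):
  `defRow_card_le` — forms supported on `{a₀₁, a₀₂}`: `R(⟨2,3,3⟩) + 3 + k ≤ |σ| + ⌊k/2⌋`, so
  `k ≤ 2` when `|σ| ≤ 19` and `R(⟨2,3,3⟩) ≥ 15` (`defRow_card_le_two`); `fullRow_card_le` — forms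
  supported on a full row `i₀ ≠ 0`: `R(⟨2,3,3⟩ minus a₀₀) + 3 + k ≤ |σ| + ⌊k/3⌋`; and the column
  versions through the symmetry `(A,B,C) ↦ (Aᵀ,Cᵀ,Bᵀ)`, which preserves `W`.

## References

* [HopcroftKerr1971] J. E. Hopcroft, L. R. Kerr, SIAM J. Appl. Math. 20 (1971) 30–36 (Cornell CS
  TR 69-44, 1969), Lemma 7 and its proof (pp. 22–23), the substitution technique p. 20.
* [BurgisserClausenShokrollahi1997] Bürgisser–Clausen–Shokrollahi, *Algebraic Complexity Theory*,
  Prop. (14.45)(1), Lemma (17.17).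
-/

noncomputable section

open scoped BigOperators

namespace Literature.Computability.AlgebraicComplexity

namespace HopcroftKerrRow

open Module Submodule OptimalDecomposition

variable {K : Type*} [Field K]

/-- Output slices of a fixed row `i₀` of the entry-restricted matrix multiplication tensor are
linearly independent as soon as row `i₀` keeps one admissible entry. [cite: HopcroftKerr1971, Lemma 7 (proof)] -/
theorem linearIndependent_slices_row_restrict {m p n : ℕ} (Pr : Fin m × Fin p → Prop)
    [DecidablePred Pr] (i₀ : Fin m) (μ₀ : Fin p) (hμ₀ : Pr (i₀, μ₀)) :
    LinearIndependent K (fun l : Fin n =>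
      (fun (b : {b : Fin m × Fin p // Pr b}) (c : Fin p × Fin n) =>
        matMulTensor K m p n (i₀, l) b.1 c)) := by
  rw [Fintype.linearIndependent_iff]
  intro g hg l
  have h := congr_fun (congr_fun hg ⟨(i₀, μ₀), hμ₀⟩) (μ₀, l)
  simp only [Finset.sum_apply, Pi.smul_apply, matMulTensor, smul_eq_mul, Pi.zero_apply] at h
  rw [Finset.sum_eq_single l] at h
  · simpa using h
  · intro l' _ hl'
    simp [hl']
  · simp

/-- The row at an admissible entry `(i₀, μ₁)` of `∑_l c_l · slice (i₀, l)` is `e_{μ₁} ⊗ c`.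
[cite: HopcroftKerr1971, Lemma 7 (proof)] -/
theorem row_sum_slices_restrict {m p n : ℕ} (Pr : Fin m × Fin p → Prop) [DecidablePred Pr]
    (i₀ : Fin m) (c : Fin n → K) (μ₁ : Fin p) (hμ₁ : Pr (i₀, μ₁)) :
    (∑ l, c l • (fun (b : {b : Fin m × Fin p // Pr b}) (d : Fin p × Fin n) =>
        matMulTensor K m p n (i₀, l) b.1 d)) ⟨(i₀, μ₁), hμ₁⟩ =
      fun d : Fin p × Fin n => if d.1 = μ₁ then c d.2 else 0 := by
  funext d
  simp only [Finset.sum_apply, Pi.smul_apply, matMulTensor, smul_eq_mul, true_and]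
  rw [Finset.sum_eq_single d.2]
  · by_cases h : d.1 = μ₁
    · simp [h]
    · have h' : ¬ μ₁ = d.1 := fun e => h e.symm
      simp [h, h']
  · intro l _ hl
    simp [hl]
  · simp

/-- **Overlap bound, restricted form**: with `p'` admissible entries in row `i₀`,
`p' · dim (S ∩ M) ≤ |D|`. [cite: HopcroftKerr1971, Lemma 7 (proof: Winograd's Theorem 2)] -/
theorem mul_finrank_inf_le_card_restrict {m p n : ℕ} (Pr : Fin m × Fin p → Prop)
    [DecidablePred Pr] {σ : Type*} [Fintype σ] (i₀ : Fin m)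
    (u : σ → {b : Fin m × Fin p // Pr b} → K) (v : σ → Fin p × Fin n → K) (D : Finset σ) :
    Fintype.card {μ : Fin p // Pr (i₀, μ)} *
      finrank K ↥(span K (Set.range fun l : Fin n =>
          (fun (b : {b : Fin m × Fin p // Pr b}) (c : Fin p × Fin n) =>
            matMulTensor K m p n (i₀, l) b.1 c)) ⊓
        span K (Set.range fun ρ : D => (fun b c => u ρ b * v ρ c :
          {b : Fin m × Fin p // Pr b} → Fin p × Fin n → K))) ≤ D.card := by
  classical
  set V := ({b : Fin m × Fin p // Pr b} → Fin p × Fin n → K)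
  set sl : Fin n → V := fun l b c => matMulTensor K m p n (i₀, l) b.1 c with hsl
  set S : Submodule K V := span K (Set.range sl) with hS
  set M : Submodule K V := span K (Set.range fun ρ : D => (fun b c => u ρ b * v ρ c : V)) with hM
  set L := S ⊓ M with hL
  let X : (Fin n → K) →ₗ[K] V := Fintype.linearCombination K sl
  have hXapply : ∀ c, X c = ∑ l, c l • sl l := fun c => Fintype.linearCombination_apply K _ c
  have hXrange : LinearMap.range X = S := by rw [hS, Fintype.range_linearCombination]
  set C : Submodule K (Fin n → K) := L.comap X with hC
  have hLle : L ≤ C.map X := by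
    intro y hy
    have hyS : y ∈ LinearMap.range X := by rw [hXrange]; exact inf_le_left (a := S) (b := M) hy
    obtain ⟨c, rfl⟩ := hyS
    exact ⟨c, hy, rfl⟩
  have hdimL : finrank K L ≤ finrank K C :=
    (Submodule.finrank_mono hLle).trans (Submodule.finrank_map_le X C)
  set P' := {μ : Fin p // Pr (i₀, μ)}
  let Θ : (P' → ↥C) →ₗ[K] (Fin p × Fin n → K) :=
    { toFun := fun d e => if h : Pr (i₀, e.1) then ((d ⟨e.1, h⟩ : ↥C) : Fin n → K) e.2 else 0
      map_add' := fun d d' => by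
        funext e
        by_cases h : Pr (i₀, e.1) <;> simp [h]
      map_smul' := fun r d => by
        funext e
        by_cases h : Pr (i₀, e.1) <;> simp [h] }
  have hΘapply : ∀ d e, Θ d e =
      if h : Pr (i₀, e.1) then ((d ⟨e.1, h⟩ : ↥C) : Fin n → K) e.2 else 0 := fun d e => rfl
  have hΘinj : Function.Injective Θ := by
    intro d d' h
    funext μ
    apply Subtype.ext
    funext ν
    have := congr_fun h (μ.1, ν)
    simpa [hΘapply, μ.2] using this
  have hrow : ∀ (c : Fin n → K) (μ : P'), (X c) ⟨(i₀, μ.1), μ.2⟩ =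
      fun e : Fin p × Fin n => if e.1 = μ.1 then c e.2 else 0 := fun c μ => by
    rw [hXapply]; exact row_sum_slices_restrict Pr i₀ c μ.1 μ.2
  have hΘle : LinearMap.range Θ ≤ ⨆ b : {b : Fin m × Fin p // Pr b}, L.map
      (LinearMap.proj b : V →ₗ[K] (Fin p × Fin n → K)) := by
    rintro _ ⟨d, rfl⟩
    have hdec : Θ d = ∑ μ : P', (X (d μ : Fin n → K)) ⟨(i₀, μ.1), μ.2⟩ := by
      funext e
      rw [Finset.sum_apply]
      simp_rw [hrow]
      rw [hΘapply]
      by_cases h : Pr (i₀, e.1)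
      · rw [dif_pos h, Finset.sum_eq_single (⟨e.1, h⟩ : P')]
        · simp
        · intro μ _ hne
          have hne' : e.1 ≠ μ.1 := fun h' => hne (Subtype.ext h'.symm)
          simp [hne']
        · simp
      · rw [dif_neg h]
        symm
        refine Finset.sum_eq_zero fun μ _ => ?_
        have hne' : e.1 ≠ μ.1 := fun h' => h (h' ▸ μ.2)
        simp [hne']
    rw [hdec]
    refine Submodule.sum_mem _ fun μ _ => ?_
    exact (le_iSup (fun b : {b : Fin m × Fin p // Pr b} => L.map
      (LinearMap.proj b : V →ₗ[K] (Fin p × Fin n → K))) ⟨(i₀, μ.1), μ.2⟩)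
      (Submodule.mem_map_of_mem (f := (LinearMap.proj (⟨(i₀, μ.1), μ.2⟩ : {b // Pr b}) :
        V →ₗ[K] (Fin p × Fin n → K))) (d μ).2)
  have hmono : (⨆ b : {b : Fin m × Fin p // Pr b}, L.map
      (LinearMap.proj b : V →ₗ[K] (Fin p × Fin n → K))) ≤
      ⨆ b : {b : Fin m × Fin p // Pr b}, M.map (LinearMap.proj b : V →ₗ[K] (Fin p × Fin n → K)) :=
    iSup_mono fun _ => Submodule.map_mono inf_le_right
  have hMrows : (⨆ b : {b : Fin m × Fin p // Pr b}, M.map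
      (LinearMap.proj b : V →ₗ[K] (Fin p × Fin n → K))) ≤ span K (Set.range fun ρ : D => v ρ) := by
    refine iSup_le fun b => ?_
    rw [hM, Submodule.map_span, Submodule.span_le]
    rintro _ ⟨_, ⟨ρ, rfl⟩, rfl⟩
    have : (LinearMap.proj b : V →ₗ[K] (Fin p × Fin n → K)) (fun b c => u ρ b * v ρ c) =
        u ρ b • v ρ := by
      funext c; simp [LinearMap.proj_apply]
    rw [SetLike.mem_coe, this]
    exact Submodule.smul_mem _ _ (subset_span ⟨ρ, rfl⟩)
  have h1 : Fintype.card P' * finrank K C = finrank K (P' → ↥C) := by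
    rw [Module.finrank_pi_fintype, Finset.sum_const, Finset.card_univ, smul_eq_mul]
  have h2 : finrank K (P' → ↥C) = finrank K (LinearMap.range Θ) :=
    (LinearMap.finrank_range_of_inj hΘinj).symm
  have h3 : finrank K (LinearMap.range Θ) ≤ finrank K (span K (Set.range fun ρ : D => v ρ)) :=
    Submodule.finrank_mono (hΘle.trans (hmono.trans hMrows))
  have h4 : finrank K (span K (Set.range fun ρ : D => v ρ)) ≤ D.card :=
    (finrank_range_le_card _).trans (by rw [Fintype.card_coe])
  calc Fintype.card P' * finrank K L ≤ Fintype.card P' * finrank K C :=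
        Nat.mul_le_mul_left _ hdimL
    _ ≤ D.card := by rw [h1, h2]; exact h3.trans h4

/-- **Hopcroft–Kerr 1971, Lemma 7 — entry-restricted row form.**  Let `T` be `⟨m, p, n⟩` with the
first matrix `A` restricted to the admissible entries `Pr` (the other entries set to `0`), and let
`∑_{ρ∈σ} w_ρ ⊗ u_ρ ⊗ v_ρ = T`.  Fix a row `i₀` with an admissible entry `(i₀, μ₀)`, let `p'` be the number
of admissible entries of row `i₀`, and let `D` be a set of terms whose `A`-forms are supported on row
`i₀`.  For any further restriction `g` of the admissible entries AVOIDING row `i₀` (and any map `f` of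
output indices; `T' = T ∘ (f × g × 1)`, e.g. "delete row `i₀`"): `R(T') + n + |D| ≤ |σ| + ⌊|D| / p'⌋`.
[cite: HopcroftKerr1971, Lemma 7] -/
theorem hopcroftKerr1971_lemma7_row_restrict {m p n : ℕ} (Pr : Fin m × Fin p → Prop)
    [DecidablePred Pr] (i₀ : Fin m) (μ₀ : Fin p) (hμ₀ : Pr (i₀, μ₀)) {σ : Type*} [Fintype σ]
    [DecidableEq σ] {w : σ → Fin m × Fin n → K} {u : σ → {b : Fin m × Fin p // Pr b} → K}
    {v : σ → Fin p × Fin n → K}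
    (ht : (fun (a : Fin m × Fin n) (b : {b : Fin m × Fin p // Pr b}) (c : Fin p × Fin n) =>
      matMulTensor K m p n a b.1 c) = ∑ ρ, triad (w ρ) (u ρ) (v ρ))
    (D : Finset σ) (hD : ∀ ρ ∈ D, ∀ b : {b : Fin m × Fin p // Pr b}, b.1.1 ≠ i₀ → u ρ b = 0)
    {ι' κ'' : Type*} [Fintype ι'] [Fintype κ''] (f : ι' → Fin m × Fin n)
    (g : κ'' → {b : Fin m × Fin p // Pr b}) (hg : ∀ b'', (g b'').1.1 ≠ i₀) :
    tensorRank (fun a' b'' c => matMulTensor K m p n (f a') (g b'').1 c) + n + D.card ≤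
      Fintype.card σ + D.card / Fintype.card {μ : Fin p // Pr (i₀, μ)} := by
  classical
  set I : Finset (Fin m × Fin n) := Finset.univ.image fun l : Fin n => (i₀, l) with hI
  have hIcard : I.card = n := by
    rw [hI, Finset.card_image_of_injective _ (fun l l' h => (Prod.ext_iff.1 h).2), Finset.card_univ,
      Fintype.card_fin]
  have hmemI : ∀ a ∈ I, a.1 = i₀ := by
    intro a ha
    obtain ⟨l, -, rfl⟩ := Finset.mem_image.1 ha
    rfl
  set T := (fun (a : Fin m × Fin n) (b : {b : Fin m × Fin p // Pr b}) (c : Fin p × Fin n) =>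
      matMulTensor K m p n a b.1 c) with hT
  have hind : LinearIndependent K (fun a : I => T (a : Fin m × Fin n)) := by
    let e : Fin n ≃ I :=
      { toFun := fun l => ⟨(i₀, l), Finset.mem_image.2 ⟨l, Finset.mem_univ _, rfl⟩⟩
        invFun := fun a => (a : Fin m × Fin n).2
        left_inv := fun l => rfl
        right_inv := fun a => by
          apply Subtype.ext
          exact Prod.ext (hmemI a a.2).symm rfl }
    have h0 := linearIndependent_slices_row_restrict (K := K) (n := n) Pr i₀ μ₀ hμ₀
    have : (fun a : I => T (a : Fin m × Fin n)) ∘ e = fun l : Fin n => T (i₀, l) := by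
      funext l; rfl
    rw [← linearIndependent_equiv e, this]
    exact h0
  have hp' : 0 < Fintype.card {μ : Fin p // Pr (i₀, μ)} :=
    Fintype.card_pos_iff.2 ⟨⟨μ₀, hμ₀⟩⟩
  have hq : finrank K ↥(span K (Set.range fun a : I => T (a : Fin m × Fin n)) ⊓
      span K (Set.range fun ρ : D => (fun b c => u ρ b * v ρ c :
        {b : Fin m × Fin p // Pr b} → Fin p × Fin n → K))) ≤
      D.card / Fintype.card {μ : Fin p // Pr (i₀, μ)} := by
    have hrange : (Set.range fun a : I => T (a : Fin m × Fin n)) =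
        Set.range fun l : Fin n => T (i₀, l) := by
      ext y
      constructor
      · rintro ⟨a, rfl⟩
        obtain ⟨l, -, hl⟩ := Finset.mem_image.1 a.2
        refine ⟨l, ?_⟩
        show T (i₀, l) = T a
        rw [hl]
      · rintro ⟨l, rfl⟩
        exact ⟨⟨(i₀, l), Finset.mem_image.2 ⟨l, Finset.mem_univ _, rfl⟩⟩, rfl⟩
    rw [hrange, Nat.le_div_iff_mul_le hp', mul_comm]
    exact mul_finrank_inf_le_card_restrict Pr i₀ u v D
  have hmain := tensorRank_precomp_add_card_add_card_le ht f g D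
    (fun ρ hρ b'' => hD ρ hρ _ (hg b''))
    I (fun a ha b'' c => by
      have h1 : a.1 ≠ (g b'').1.1 := by rw [hmemI a ha]; exact (hg b'').symm
      simp [hT, matMulTensor, h1])
    hind (D.card / Fintype.card {μ : Fin p // Pr (i₀, μ)}) hq
  rw [hIcard] at hmain
  have : tensorRank (fun a' b'' c => T (f a') (g b'') c) =
      tensorRank (fun a' b'' c => matMulTensor K m p n (f a') (g b'').1 c) := rfl
  omega

/-! ## `⟨3,3,3⟩` with `a₀₀ = 0` (the constrained tensor of the orbit of `E₀₀`) -/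

/-- **Deficient row of `⟨3,3,3⟩ minus a₀₀`**: if `k` terms of a decomposition of length `|σ|` have their
`A`-form supported on `{a₀₁, a₀₂}`, then `R(⟨2,3,3⟩) + 3 + k ≤ |σ| + ⌊k/2⌋` (overlap factor 2: row 0
keeps two admissible entries). [cite: HopcroftKerr1971, Lemma 7] -/
theorem defRow_card_le {σ : Type*} [Fintype σ] [DecidableEq σ]
    {w : σ → Fin 3 × Fin 3 → K} {u : σ → {b : Fin 3 × Fin 3 // b ≠ (0, 0)} → K}
    {v : σ → Fin 3 × Fin 3 → K} (ht : (fun (a : Fin 3 × Fin 3) (b : {b : Fin 3 × Fin 3 // b ≠ (0, 0)}) (c : Fin 3 × Fin 3) =>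
      matMulTensor K 3 3 3 a b.1 c) = ∑ ρ, triad (w ρ) (u ρ) (v ρ))
    (D : Finset σ) (hD : ∀ ρ ∈ D, ∀ b : {b : Fin 3 × Fin 3 // b ≠ (0, 0)}, b.1.1 ≠ 0 → u ρ b = 0) :
    tensorRank (matMulTensor K 2 3 3) + 3 + D.card ≤ Fintype.card σ + D.card / 2 := by
  have hcard : Fintype.card {μ : Fin 3 // ((0 : Fin 3), μ) ≠ ((0 : Fin 3), (0 : Fin 3))} = 2 := by decide
  have h := hopcroftKerr1971_lemma7_row_restrict (K := K) (fun b : Fin 3 × Fin 3 => b ≠ (0, 0)) (0 : Fin 3)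
    (1 : Fin 3) (by decide)
    ht D hD
    (fun a' : Fin 2 × Fin 3 => ((a'.1.succ, a'.2) : Fin 3 × Fin 3))
    (fun b' : Fin 2 × Fin 3 => (⟨(b'.1.succ, b'.2), by simp [Fin.succ_ne_zero]⟩ :
      {b : Fin 3 × Fin 3 // b ≠ (0, 0)})) (fun b' => Fin.succ_ne_zero _)
  have hT : (fun (a' : Fin 2 × Fin 3) (b'' : Fin 2 × Fin 3) (c : Fin 3 × Fin 3) =>
      matMulTensor K 3 3 3 (a'.1.succ, a'.2) (b''.1.succ, b''.2) c) = matMulTensor K 2 3 3 := by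
    funext a' b'' c
    simp only [matMulTensor, Fin.succ_inj]
  rw [hcard, hT] at h
  exact h

/-- Hence, for a decomposition of `⟨3,3,3⟩ minus a₀₀` of length `≤ 19` over a field with `R(⟨2,3,3⟩) ≥ 15`
(`𝔽₂`), **at most 2 terms** have `A`-form supported on `{a₀₁, a₀₂}` (plain substitution: `≤ 4`).
[cite: HopcroftKerr1971, Lemma 7] -/
theorem defRow_card_le_two {σ : Type*} [Fintype σ] [DecidableEq σ]
    (h15 : 15 ≤ tensorRank (matMulTensor K 2 3 3))
    {w : σ → Fin 3 × Fin 3 → K} {u : σ → {b : Fin 3 × Fin 3 // b ≠ (0, 0)} → K}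
    {v : σ → Fin 3 × Fin 3 → K} (ht : (fun (a : Fin 3 × Fin 3) (b : {b : Fin 3 × Fin 3 // b ≠ (0, 0)}) (c : Fin 3 × Fin 3) =>
      matMulTensor K 3 3 3 a b.1 c) = ∑ ρ, triad (w ρ) (u ρ) (v ρ))
    (hσ : Fintype.card σ ≤ 19)
    (D : Finset σ) (hD : ∀ ρ ∈ D, ∀ b : {b : Fin 3 × Fin 3 // b ≠ (0, 0)}, b.1.1 ≠ 0 → u ρ b = 0) :
    D.card ≤ 2 := by
  have h := defRow_card_le ht D hD
  omega

/-- A full row of `W = {a₀₀ = 0}` has three admissible entries. [folklore] -/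
private theorem card_row_W00 :
    ∀ i₀ : Fin 3, i₀ ≠ 0 → Fintype.card {μ : Fin 3 // ((i₀, μ) : Fin 3 × Fin 3) ≠ (0, 0)} = 3 := by decide

/-- Deleting a full row `i₀ ≠ 0` of `W` leaves the pattern "all but `(0,0)`". [folklore] -/
private theorem W00_succAbove :
    ∀ i₀ : Fin 3, i₀ ≠ 0 → ∀ (i : Fin 2) (μ : Fin 3), ((i, μ) : Fin 2 × Fin 3) ≠ (0, 0) →
      ((i₀.succAbove i, μ) : Fin 3 × Fin 3) ≠ (0, 0) := by decide

/-- `(i₀, 0)` is admissible for `i₀ ≠ 0`. [folklore] -/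
private theorem W00_row_zero : ∀ i₀ : Fin 3, i₀ ≠ 0 → ((i₀, (0 : Fin 3)) : Fin 3 × Fin 3) ≠ (0, 0) := by decide

/-- **Full row `i₀ ≠ 0` of `⟨3,3,3⟩ minus a₀₀`**: `R(⟨2,3,3⟩ minus a₀₀) + 3 + k ≤ |σ| + ⌊k/3⌋` for the `k`
terms whose `A`-form is supported on row `i₀`. [cite: HopcroftKerr1971, Lemma 7] -/
theorem fullRow_card_le {σ : Type*} [Fintype σ] [DecidableEq σ]
    {w : σ → Fin 3 × Fin 3 → K} {u : σ → {b : Fin 3 × Fin 3 // b ≠ (0, 0)} → K}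
    {v : σ → Fin 3 × Fin 3 → K} (ht : (fun (a : Fin 3 × Fin 3) (b : {b : Fin 3 × Fin 3 // b ≠ (0, 0)}) (c : Fin 3 × Fin 3) =>
      matMulTensor K 3 3 3 a b.1 c) = ∑ ρ, triad (w ρ) (u ρ) (v ρ))
    (i₀ : Fin 3) (hi₀ : i₀ ≠ 0)
    (D : Finset σ) (hD : ∀ ρ ∈ D, ∀ b : {b : Fin 3 × Fin 3 // b ≠ (0, 0)}, b.1.1 ≠ i₀ → u ρ b = 0) :
    tensorRank ((fun (a : Fin 2 × Fin 3) (b : {b : Fin 2 × Fin 3 // b ≠ (0, 0)}) (c : Fin 3 × Fin 3) =>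
      matMulTensor K 2 3 3 a b.1 c)) + 3 + D.card ≤ Fintype.card σ + D.card / 3 := by
  have hcard : Fintype.card {μ : Fin 3 // ((i₀, μ) : Fin 3 × Fin 3) ≠ (0, 0)} = 3 := card_row_W00 i₀ hi₀
  have hadm : ∀ b' : {b : Fin 2 × Fin 3 // b ≠ (0, 0)},
      ((i₀.succAbove b'.1.1, b'.1.2) : Fin 3 × Fin 3) ≠ (0, 0) :=
    fun b' => W00_succAbove i₀ hi₀ b'.1.1 b'.1.2 (by simpa [Prod.ext_iff] using b'.2)
  have h := hopcroftKerr1971_lemma7_row_restrict (K := K) (fun b : Fin 3 × Fin 3 => b ≠ (0, 0)) i₀ (0 : Fin 3)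
    (W00_row_zero i₀ hi₀) ht D hD
    (fun a' : Fin 2 × Fin 3 => ((i₀.succAbove a'.1, a'.2) : Fin 3 × Fin 3))
    (fun b' : {b : Fin 2 × Fin 3 // b ≠ (0, 0)} =>
      (⟨(i₀.succAbove b'.1.1, b'.1.2), hadm b'⟩ : {b : Fin 3 × Fin 3 // b ≠ (0, 0)}))
    (fun b' => Fin.succAbove_ne i₀ _)
  have hT : (fun (a' : Fin 2 × Fin 3) (b'' : {b : Fin 2 × Fin 3 // b ≠ (0, 0)}) (c : Fin 3 × Fin 3) =>
      matMulTensor K 3 3 3 (i₀.succAbove a'.1, a'.2) (i₀.succAbove b''.1.1, b''.1.2) c) =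
      (fun (a : Fin 2 × Fin 3) (b : {b : Fin 2 × Fin 3 // b ≠ (0, 0)}) (c : Fin 3 × Fin 3) =>
      matMulTensor K 2 3 3 a b.1 c) := by
    funext a' b'' c
    simp only [matMulTensor, Fin.succAbove_right_inj]
  rw [hcard, hT] at h
  exact h

/-- The symmetry `(A,B,C) ↦ (Aᵀ,Cᵀ,Bᵀ)` preserves `W = {a₀₀ = 0}`: a decomposition of `⟨3,3,3⟩ minus a₀₀`
yields one of the same length with transposed `A`-forms. [cite: HopcroftKerr1971, Lemma 7 (Corollary)] -/
theorem T333minus00_swap_transpose_eq_sum {σ : Type*} [Fintype σ]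
    {w : σ → Fin 3 × Fin 3 → K} {u : σ → {b : Fin 3 × Fin 3 // b ≠ (0, 0)} → K}
    {v : σ → Fin 3 × Fin 3 → K} (ht : (fun (a : Fin 3 × Fin 3) (b : {b : Fin 3 × Fin 3 // b ≠ (0, 0)}) (c : Fin 3 × Fin 3) =>
      matMulTensor K 3 3 3 a b.1 c) = ∑ ρ, triad (w ρ) (u ρ) (v ρ)) :
    (fun (a : Fin 3 × Fin 3) (b : {b : Fin 3 × Fin 3 // b ≠ (0, 0)}) (c : Fin 3 × Fin 3) =>
      matMulTensor K 3 3 3 a b.1 c) = ∑ ρ, triad (v ρ)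
      (fun b : {b : Fin 3 × Fin 3 // b ≠ (0, 0)} => u ρ ⟨b.1.swap, fun h => b.2 (by
        have := congrArg Prod.swap h; simpa using this)⟩) (w ρ) := by
  have key : (fun (a : Fin 3 × Fin 3) (b : {b : Fin 3 × Fin 3 // b ≠ (0, 0)}) (c : Fin 3 × Fin 3) =>
      matMulTensor K 3 3 3 a b.1 c) = fun a b c => (fun (a : Fin 3 × Fin 3) (b : {b : Fin 3 × Fin 3 // b ≠ (0, 0)}) (c : Fin 3 × Fin 3) =>
      matMulTensor K 3 3 3 a b.1 c) c
      ⟨b.1.swap, fun h => b.2 (by have := congrArg Prod.swap h; simpa using this)⟩ a := by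
    funext a b c
    simp only [matMulTensor, Prod.fst_swap, Prod.snd_swap]
    by_cases h : (c.1 = b.1.2 ∧ b.1.1 = a.1 ∧ c.2 = a.2)
    · have h' : a.1 = b.1.1 ∧ b.1.2 = c.1 ∧ a.2 = c.2 := ⟨h.2.1.symm, h.1.symm, h.2.2.symm⟩
      rw [if_pos h', if_pos h]
    · have h' : ¬ (a.1 = b.1.1 ∧ b.1.2 = c.1 ∧ a.2 = c.2) :=
        fun hh => h ⟨hh.2.1.symm, hh.1.symm, hh.2.2.symm⟩
      rw [if_neg h', if_neg h]
  rw [key]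
  conv_lhs => rw [ht]
  funext a b c
  simp only [Finset.sum_apply, triad_apply]
  exact Finset.sum_congr rfl fun ρ _ => by ring

/-- **Deficient column of `⟨3,3,3⟩ minus a₀₀`**: at most `⌊k/2⌋` credit — `R(⟨2,3,3⟩) + 3 + k ≤ |σ| + ⌊k/2⌋`
for the `k` terms with `A`-form supported on `{a₁₀, a₂₀}`; hence `k ≤ 2` at length `≤ 19` when
`R(⟨2,3,3⟩) ≥ 15`. [cite: HopcroftKerr1971, Lemma 7 (Corollary)] -/
theorem defCol_card_le_two {σ : Type*} [Fintype σ] [DecidableEq σ]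
    (h15 : 15 ≤ tensorRank (matMulTensor K 2 3 3))
    {w : σ → Fin 3 × Fin 3 → K} {u : σ → {b : Fin 3 × Fin 3 // b ≠ (0, 0)} → K}
    {v : σ → Fin 3 × Fin 3 → K} (ht : (fun (a : Fin 3 × Fin 3) (b : {b : Fin 3 × Fin 3 // b ≠ (0, 0)}) (c : Fin 3 × Fin 3) =>
      matMulTensor K 3 3 3 a b.1 c) = ∑ ρ, triad (w ρ) (u ρ) (v ρ))
    (hσ : Fintype.card σ ≤ 19)
    (D : Finset σ) (hD : ∀ ρ ∈ D, ∀ b : {b : Fin 3 × Fin 3 // b ≠ (0, 0)}, b.1.2 ≠ 0 → u ρ b = 0) :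
    D.card ≤ 2 :=
  defRow_card_le_two h15 (T333minus00_swap_transpose_eq_sum ht) hσ D
    (fun ρ hρ b hb => hD ρ hρ _ (by simpa using hb))

/-- **Full column `j₀ ≠ 0` of `⟨3,3,3⟩ minus a₀₀`**: `R(⟨2,3,3⟩ minus a₀₀) + 3 + k ≤ |σ| + ⌊k/3⌋`.
[cite: HopcroftKerr1971, Lemma 7 (Corollary)] -/
theorem fullCol_card_le {σ : Type*} [Fintype σ] [DecidableEq σ]
    {w : σ → Fin 3 × Fin 3 → K} {u : σ → {b : Fin 3 × Fin 3 // b ≠ (0, 0)} → K}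
    {v : σ → Fin 3 × Fin 3 → K} (ht : (fun (a : Fin 3 × Fin 3) (b : {b : Fin 3 × Fin 3 // b ≠ (0, 0)}) (c : Fin 3 × Fin 3) =>
      matMulTensor K 3 3 3 a b.1 c) = ∑ ρ, triad (w ρ) (u ρ) (v ρ))
    (j₀ : Fin 3) (hj₀ : j₀ ≠ 0)
    (D : Finset σ) (hD : ∀ ρ ∈ D, ∀ b : {b : Fin 3 × Fin 3 // b ≠ (0, 0)}, b.1.2 ≠ j₀ → u ρ b = 0) :
    tensorRank ((fun (a : Fin 2 × Fin 3) (b : {b : Fin 2 × Fin 3 // b ≠ (0, 0)}) (c : Fin 3 × Fin 3) =>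
      matMulTensor K 2 3 3 a b.1 c)) + 3 + D.card ≤ Fintype.card σ + D.card / 3 :=
  fullRow_card_le (T333minus00_swap_transpose_eq_sum ht) j₀ hj₀ D
    (fun ρ hρ b hb => hD ρ hρ _ (by simpa using hb))

end HopcroftKerrRow

end Literature.Computability.AlgebraicComplexity
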